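import Summits.Ventures.QEC.Census.CertCoverBatch
import Summits.Ventures.QEC.Census.BB.A1s_n168_k6_b088e501.CoreDefs
import HarnessLib

set_option Elab.async false
set_option maxRecDepth 200000

/-!
# `[[168,6,16]]` one-level cover certificate of `A1s_n168_k6_b088e501` — LEVEL-1→0 coset problems 271…297 (deep problems [14] excluded: `ProbDeep*.lean`) as COMPACT data
(`ProbData`: U, f, σ, y₀, allow; qec-type-10 `CertCoverBatch.mkCoset` rebuilds each `CosetProb` in the kernel) + their verdict
`probsOK cov covR hx hx1 D1 lxd 14` (one `decide +kernel`; 27 problems, depths f=0:27 f=1:0 f=2:0 f=3:0, est. 94.5 s).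
qec-search-1 g5 (pattern of search-9 g5 `Probs*`); data from JSON `level10.problems` (sha256 2bd67f9f8666097b…). Data + decided check; KERNEL.
-/

namespace Summit.Ventures.QEC.Census.A1s_n168_k6_b088e501

open Matrix Summit.Ventures.QEC.Census Literature.InformationTheory.QuantumCodes

/-- Problems 271…297 (27): `⟨U, f, σ, y₀, allow⟩`. -/
def probs06a : List ProbData := [
    ⟨4207012910620884566336, 0, 412454829056, 1254378667384100321354, []⟩,
    ⟨4356894895905771323392, 0, 275015879680, 3615561856047848292352, [0]⟩,
    ⟨4429601122630669049872, 0, 412457468160, 4429524420700446282638, []⟩,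
    ⟨5908884878080114032897, 0, 687222038546, 5782659304981004544, [0]⟩,
    ⟨5909947867307486543872, 0, 1649314631680, 4683884436980269320, []⟩,
    ⟨5911181957981621846050, 0, 687205253665, 1185356429140366590982, []⟩,
    ⟨5923710867699942099014, 0, 549761061984, 4724672501826917642712, []⟩,
    ⟨6059908603378021777666, 0, 695802808353, 1337542085360003714803, []⟩,
    ⟨6935984921921433182336, 0, 1821201516545, 1588891648, []⟩,
    ⟨10626840188469941805072, 0, 1254300844288, 10625612957575044408089, []⟩,
    ⟨10921652821766560809985, 0, 1236954812435, 9445895175918573589896, []⟩,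
    ⟨10923949552165372297474, 0, 1309969256482, 9739898885323674297634, []⟩,
    ⟨10930866905163543871493, 0, 1786710626386, 10394343124385267712, []⟩,
    ⟨10943533314282758472736, 0, 1511847395840, 1180591761457133847568, []⟩,
    ⟨11086493509702580766848, 0, 171799796224, 313594649325081832910, []⟩,
    ⟨13281948537425131634944, 0, 1391609819136, 13281948467047621611654, []⟩,
    ⟨13282899008185035653376, 0, 1584851357698, 1181744823836936971296, []⟩,
    ⟨20072475017632100647176, 0, 2439541430404, 18889504229674178451676, []⟩,
    ⟨20074777397267750453258, 0, 3573412798628, 18894149675176946041354, []⟩,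
    ⟨20074815610861515702272, 0, 524002787840, 18889612298604463022609, []⟩,
    ⟨20088704709751690297353, 0, 2336513597590, 1180629904630085132564, []⟩,
    ⟨20107536553385952051296, 0, 38722343425, 1217494161241321562693, []⟩,
    ⟨20368666546325734564114, 0, 1241379811616, 1478045371176337881550, []⟩,
    ⟨20477617564814300774400, 0, 240721101824, 74942149601410490368, []⟩,
    ⟨22433623340847784001538, 0, 1378688696352, 21250721371313918443522, [0]⟩,
    ⟨24797184482885907775492, 0, 1653579186240, 1185207812543129583616, [0]⟩,
    ⟨24977513680911676342400, 0, 2886287247877, 23759406512348317358228, []⟩]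

set_option maxHeartbeats 400000000 in
/-- Every problem of this chunk passes (`mkCoset` elimination + `cosetOKD` + fast `σ` + depth + `BU`-evenness + label checks). -/
theorem probs06a_ok : probsOK A1s_n168_k6_b088e501.cov covR hx hx1 D1 lxd 14 probs06a = true := by
  decide +kernel

/-- Pointwise form. -/
theorem probs06a_all : ∀ x ∈ probs06a, probOK A1s_n168_k6_b088e501.cov covR hx hx1 D1 lxd 14 x = true := by
  have h := probs06a_ok
  rwa [probsOK, List.all_eq_true] at h

end Summit.Ventures.QEC.Census.A1s_n168_k6_b088e501
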